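import Literature.MathematicalPhysics.QuantumFieldTheory.Federbush1986.NonAbelianDualitySUN
import Literature.MathematicalPhysics.QuantumFieldTheory.Federbush1986.PureAveragesSUN

/-!
# `Federbush1986.NonAbelianDualitySUNBridge` — [Federbush1987PhaseCellVI] / [Federbush1987PhaseCellIII] the two `SU(N)`
# objects of the cell are ONE: p32's III-side carrier `SUN N` / `suN N` / `expSUN` (`PureAveragesSUN`) and r17's VI-side
# `SUNSubgroup N : UNLieSubgroup N` (`NonAbelianDualitySUN`) have the same subgroup, the same Lie algebra, the same distance
# and the same exponential (isometric group isomorphism; theorems + two structure-preserving equivalences)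

statement-level skeleton of published theorems with citation tags; proofs where landed; nothing here is a claim about the Yang–Mills mass gap

CITATION HEADER.  P. Federbush, *A phase cell approach to Yang–Mills theory. VI. Non-abelian lattice-continuum duality*,
Ann. Inst. H. Poincaré **47** (1987) 17–23 [Federbush1987PhaseCellVI], p. 18–19 («a compact simple Lie group, G», (5)
«d²(Id, g) = −Tr A²»); *… III. Local stability …*, Commun. Math. Phys. **110** (1987) 293–309 [Federbush1987PhaseCellIII],
§1 p. 294–295.  lit-balaban cell (HOME `run/shared/lean/pub/lit-balaban/`), unit `lit-balaban-r17` gen 8 (fold owner of the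
Federbush rows; requested by p32 gen 8, INBOX 20:38Z), SKELETON rows F3.Lem1.0 (carrier `SUN N`, p303639) and F6.Eq1-6 /
F6.Thm1 / F6.Thm2 (`SUNSubgroup N`, `suNScheme N`, p303771) of `HOME/lit-balaban-r17/SKELETON-r17.md`.  Inputs BY NAME:
`UN.special`, `SUN`, `uN.traceZero`, `suN`, `expSUN` (+ `SUN.dist_eq`, `expSUN_coe`; p32 gen 8 `PureAveragesSUN`);
`SUNSubgroup`, `mem_SUNSubgroup_H`, `mem_SUNSubgroup_𝔥` (r17 gen 8 `NonAbelianDualitySUN`); `UNLieSubgroup.expH`/`coe_expH`,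
`lieH`/`coe_lieH` (`NonAbelianDualityUNSubgroup`).

WHY THIS FILE (honest scope).  Two seats formalised `SU(N) ⊂ U(N)` the same evening for the two papers' rows: III's §1 (pure
averages, Lemmas 1.0–1.2, (5.25), Thm 4.3: carrier type `SUN N`) and VI's block-spin scheme (Theorems 1, 2, (12), (32):
`SUNSubgroup N`, whose group is the subgroup `{det = 1}` of `UN N`).  Both are the subgroup `det = 1` of p12's `U(N)` with the
INDUCED bi-invariant length distance and the traceless skew-Hermitian Lie algebra with the Frobenius norm; this file records the
identifications so that F3 and F6 rows cite one object: the subgroups are EQUAL (`SUNSubgroup_H_eq_special`), the Lie algebras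
are EQUAL (`SUNSubgroup_𝔥_eq_traceZero`), and the tautological maps are an isometric group isomorphism `SUN N ≃* (SUNSubgroup
N).H` and a linear isometry `suN N ≃ₗᵢ[ℝ] (SUNSubgroup N).𝔥` intertwining the exponentials and the brackets.  Nothing new is
claimed about print.

CONTENTS.  `SUNSubgroup_H_eq_special`, `SUNSubgroup_𝔥_eq_traceZero`, **`SUN.toVI`** (`SUN N ≃* (SUNSubgroup N).H`) +
`coe_toVI`, `coe_toVI_symm`, `isometry_toVI`, `dist_toVI`; **`suN.toVI`** (`suN N ≃ₗᵢ[ℝ] (SUNSubgroup N).𝔥`) + `coe_toVI`;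
`SUN.toVI_expSUN` (exponentials agree), `suN.toVI_lie` (brackets agree).  No `sorry`, no new `Prop` definition, no named fact;
axioms standard.
-/

namespace Literature.MathematicalPhysics.QuantumFieldTheory.Federbush1986

noncomputable section

variable {N : ℕ}

/-- The VI-side subgroup of `SUNSubgroup N` IS p32's `UN.special N` (`det = 1`). [cite: Federbush1987PhaseCellVI, p. 18] -/
theorem SUNSubgroup_H_eq_special : (SUNSubgroup N).H = UN.special N := Subgroup.ext fun _ => Iff.rfl

/-- The VI-side Lie algebra of `SUNSubgroup N` IS p32's `uN.traceZero N` (`Tr = 0`). [cite: Federbush1987PhaseCellVI, (5) p. 19] -/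
theorem SUNSubgroup_𝔥_eq_traceZero : (SUNSubgroup N).𝔥 = uN.traceZero N := Submodule.ext fun _ => Iff.rfl

namespace SUN

/-- **The tautological group isomorphism `SUN N ≃* (SUNSubgroup N).H`** (same underlying unitary matrix).
[cite: Federbush1987PhaseCellVI, p. 18; Federbush1987PhaseCellIII, §1 p. 294] -/
def toVI : SUN N ≃* (SUNSubgroup N).H where
  toFun g := ⟨g.1, g.2⟩
  invFun h := ⟨h.1, h.2⟩
  left_inv _ := rfl
  right_inv _ := rfl
  map_mul' _ _ := rfl

/-- [cite: Federbush1987PhaseCellVI, p. 18] -/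
@[simp] theorem coe_toVI (g : SUN N) : ((toVI g : (SUNSubgroup N).H) : UN N) = g.1 := rfl

/-- [cite: Federbush1987PhaseCellVI, p. 18] -/
@[simp] theorem coe_toVI_symm (h : (SUNSubgroup N).H) : (toVI.symm h : SUN N).1 = (h : UN N) := rfl

/-- The isomorphism is an ISOMETRY (both distances are the induced length distance of `U(N)`).
[cite: Federbush1987PhaseCellVI, (5)–(6) p. 19; Federbush1987PhaseCellIII, §1 p. 294] -/
theorem dist_toVI (a b : SUN N) : dist (toVI a) (toVI b) = dist a b := rfl

/-- [cite: Federbush1987PhaseCellVI, (5)–(6) p. 19] -/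
theorem isometry_toVI : Isometry (toVI (N := N)) := Isometry.of_dist_eq dist_toVI

end SUN

namespace suN

/-- **The tautological linear isometry `suN N ≃ₗᵢ[ℝ] (SUNSubgroup N).𝔥`** (same underlying skew-Hermitian traceless matrix,
same Frobenius norm `|A|² = −Tr A²`). [cite: Federbush1987PhaseCellVI, (5) p. 19; Federbush1987PhaseCellIII, Lemma 1.0 (1.3) p. 295] -/
def toVI : suN N ≃ₗᵢ[ℝ] (SUNSubgroup N).𝔥 where
  toFun A := ⟨A.1, A.2⟩
  invFun B := ⟨B.1, B.2⟩
  left_inv _ := rfl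
  right_inv _ := rfl
  map_add' _ _ := rfl
  map_smul' _ _ := rfl
  norm_map' _ := rfl

/-- [cite: Federbush1987PhaseCellVI, (5) p. 19] -/
@[simp] theorem coe_toVI (A : suN N) : ((toVI A : (SUNSubgroup N).𝔥) : uN N) = A.1 := rfl

/-- The brackets agree: `[A, B]` of `𝔰𝔲(N)` read on either side is the matrix commutator `uNLie`.
[cite: Federbush1987PhaseCellVI, p. 18 «A ∧ A»] -/
theorem toVI_lie (A B : suN N) : ((SUNSubgroup N).lieH (toVI A) (toVI B) : uN N) = uNLie A.1 B.1 := rfl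

end suN

/-- The exponentials agree: `toVI (expSUN A) = expH (toVI A)`. [cite: Federbush1987PhaseCellVI, (5), (13) p. 19–21;
Federbush1987PhaseCellIII, Lemma 1.0 (1.3) p. 295] -/
theorem SUN.toVI_expSUN (A : suN N) : SUN.toVI (expSUN A) = (SUNSubgroup N).expH (suN.toVI A) :=
  Subtype.ext rfl

end

end Literature.MathematicalPhysics.QuantumFieldTheory.Federbush1986
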